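import Summits.KontsevichZagierPeriods.KontsevichZagierPeriods.Theorems.SoloBlindFenceChart
import HarnessLib

/-!
# The move `[M_n, w] ≡ [F_n, w]` along the fence chart

The fence chart `Y` of `SoloBlindFenceChart` is a rational map with LOWER-TRIANGULAR Jacobian
(column `0` plus the diagonal), `det DY = ∏ᵢ ∂sᵢ/∂tᵢ`, and it preserves the angle weight
coordinatewise: `W(sᵢ)·|∂sᵢ/∂tᵢ| = W(tᵢ)` (the Möbius identities of `SoloBlindTanMoves`).  Hence
KZ-rule (2) gives

  `[M_n, w] ≡ [F_n, w]`   (`minPiece_equiv_fencePiece`),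

with `F_n` the fence cell (`ℚ`-semialgebraic: `isSemialgebraic_fenceCell`).  Combined with
`SoloBlindMinCell`: `[T_n, w] = (n+2)·[F_n, w]` in `Q` for EVERY `n`
(`mkQ_cycPiece_eq_nsmul_fencePiece`).
-/

noncomputable section

open Literature.NumberTheory.Transcendental Literature.NumberTheory.Transcendental.KZ
open Literature.ModelTheory.ExponentialFields
open MeasureTheory Set MvPolynomial

namespace Summit.KontsevichZagierPeriods.KontsevichZagierPeriods.Theorems

namespace SoloBlind

variable {n : ℕ}

/-! ## The fence cell is semialgebraic -/

/-- A polynomial strict inequality `{p < q}` is `ℚ`-semialgebraic. -/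
theorem isSemialgebraic_lt (p q : MvPolynomial (Fin (n + 2)) ℚ) {f g : (Fin (n + 2) → ℝ) → ℝ}
    (hp : ∀ s, aeval s p = f s) (hq : ∀ s, aeval s q = g s) :
    IsSemialgebraic ℚ {s : Fin (n + 2) → ℝ | f s < g s} := by
  have h := isSemialgebraic_setOf_eval_lt (R := ℝ) p q
  simp only [hp, hq] at h
  exact h

/-- The fence order conditions cut out a `ℚ`-semialgebraic set. -/
theorem isSemialgebraic_setOf_isFence (n : ℕ) :
    IsSemialgebraic ℚ {s : Fin (n + 2) → ℝ | IsFence s} := by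
  have h : {s : Fin (n + 2) → ℝ | IsFence s} = ⋂ i ∈ (Finset.univ : Finset (Fin (n + 2))),
      (if i ≠ 0 ∧ i + 1 ≠ 0 then
        (if Even i.val then {s | s (i + 1) < s i} else {s | s i < s (i + 1)}) else univ) := by
    ext s
    simp only [mem_setOf_eq, IsFence, Finset.mem_univ, iInter_true, mem_iInter]
    refine forall_congr' fun i => ?_
    by_cases h0 : i ≠ 0 ∧ i + 1 ≠ 0
    · rw [if_pos h0]
      by_cases he : Even i.val
      · rw [if_pos he, mem_setOf_eq]
        exact ⟨fun h => (h h0.1 h0.2).1 he, fun h _ _ => ⟨fun _ => h, fun h' => (h' he).elim⟩⟩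
      · rw [if_neg he, mem_setOf_eq]
        exact ⟨fun h => (h h0.1 h0.2).2 he, fun h _ _ => ⟨fun h' => (he h').elim, fun _ => h⟩⟩
    · rw [if_neg h0]
      simp only [mem_univ, iff_true]
      exact fun hi hi1 => (h0 ⟨hi, hi1⟩).elim
  rw [h]
  refine IsSemialgebraic.biInter _ _ fun i _ => ?_
  split_ifs
  · exact isSemialgebraic_lt (X (i + 1)) (X i) (g := fun s => s i) (fun s => by simp)
      fun s => by simp
  · exact isSemialgebraic_lt (X i) (X (i + 1)) (g := fun s => s (i + 1)) (fun s => by simp)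
      fun s => by simp
  · exact isSemialgebraic_univ

/-- The fence cell is `ℚ`-semialgebraic. -/
theorem isSemialgebraic_fenceCell (n : ℕ) : IsSemialgebraic ℚ (fenceCell n) := by
  have h : fenceCell n = ({s : Fin (n + 2) → ℝ | 0 < s 0} ∩ {s | s 0 ^ 2 + 2 * s 0 < 1}) ∩
      (⋂ i ∈ (Finset.univ.filter (· ≠ 0) : Finset (Fin (n + 2))),
        ({s : Fin (n + 2) → ℝ | 0 < s i} ∩
          {s | s i * (1 - s 0 ^ 2) + 2 * s 0 * (1 + s i) < 1 - s 0 ^ 2})) ∩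
      {s | IsFence s} := by
    ext s
    simp only [mem_fenceCell, mem_inter_iff, mem_setOf_eq, mem_iInter, Finset.mem_filter,
      Finset.mem_univ, true_and, and_assoc]
  rw [h]
  have h1 : IsSemialgebraic ℚ {s : Fin (n + 2) → ℝ | 0 < s 0} :=
    isSemialgebraic_lt 0 (X 0) (g := fun s => s 0) (fun s => by simp) fun s => by simp
  have h2 : IsSemialgebraic ℚ {s : Fin (n + 2) → ℝ | s 0 ^ 2 + 2 * s 0 < 1} :=
    isSemialgebraic_lt (X 0 ^ 2 + 2 * X 0) 1 (f := fun s => s 0 ^ 2 + 2 * s 0) (g := fun _ => 1)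
      (fun s => by simp) fun s => by simp
  have h3 : ∀ i : Fin (n + 2), IsSemialgebraic ℚ {s : Fin (n + 2) → ℝ | 0 < s i} := fun i =>
    isSemialgebraic_lt 0 (X i) (g := fun s => s i) (fun s => by simp) fun s => by simp
  have h4 : ∀ i : Fin (n + 2), IsSemialgebraic ℚ
      {s : Fin (n + 2) → ℝ | s i * (1 - s 0 ^ 2) + 2 * s 0 * (1 + s i) < 1 - s 0 ^ 2} := fun i =>
    isSemialgebraic_lt (X i * (1 - X 0 ^ 2) + 2 * X 0 * (1 + X i)) (1 - X 0 ^ 2)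
      (f := fun s => s i * (1 - s 0 ^ 2) + 2 * s 0 * (1 + s i)) (g := fun s => 1 - s 0 ^ 2)
      (fun s => by simp) fun s => by simp
  exact ((h1.inter h2).inter (IsSemialgebraic.biInter _ _ fun i _ => (h3 i).inter (h4 i))).inter
    (isSemialgebraic_setOf_isFence n)

/-- The fence cell lies in the box. -/
theorem fenceCell_subset_kzOpenBox : fenceCell n ⊆ kzOpenBox (n + 2) := fun _ hs i =>
  bounds_of_mem_fenceCell hs i

/-- `[F_n, w]`: the fence cell with the angle weight. -/
def fencePiece (n : ℕ) : IntegralRep (n + 2) :=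
  angPiece (fenceCell n) (isSemialgebraic_fenceCell n) fenceCell_subset_kzOpenBox

/-! ## Derivative of the fence chart -/

/-- Diagonal entries `∂sᵢ/∂tᵢ` of `DY`. -/
def fenD (t : Fin (n + 2) → ℝ) (i : Fin (n + 2)) : ℝ :=
  if i = 0 then 1 else if Even i.val then -(2 * (1 + t 0 ^ 2) / (1 + t 0 + t i - t 0 * t i) ^ 2)
    else (1 + t 0 ^ 2) / (1 + t i * t 0) ^ 2

/-- Column-`0` entries `∂sᵢ/∂t₀` of `DY` (`i ≠ 0`). -/
def fenC (t : Fin (n + 2) → ℝ) (i : Fin (n + 2)) : ℝ :=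
  if i = 0 then 0 else if Even i.val then -(2 * (1 + t i ^ 2) / (1 + t 0 + t i - t 0 * t i) ^ 2)
    else -((1 + t i ^ 2) / (1 + t i * t 0) ^ 2)

/-- The derivative `DY(t)`: row `i` is `fenD t i • e_i* + fenC t i • e_0*`. -/
def fenceDeriv (t : Fin (n + 2) → ℝ) : (Fin (n + 2) → ℝ) →L[ℝ] (Fin (n + 2) → ℝ) :=
  ContinuousLinearMap.pi fun i =>
    fenD t i • ContinuousLinearMap.proj (R := ℝ) (φ := fun _ : Fin (n + 2) => ℝ) i +
      fenC t i • ContinuousLinearMap.proj (R := ℝ) (φ := fun _ : Fin (n + 2) => ℝ) 0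

/-- The derivative applied to a vector. -/
theorem fenceDeriv_apply (t v : Fin (n + 2) → ℝ) (i : Fin (n + 2)) :
    fenceDeriv t v i = fenD t i * v i + fenC t i * v 0 := by
  simp [fenceDeriv]

/-- Quotient rule in the form used below. -/
theorem hasFDerivAt_ratio {F N D : (Fin (n + 2) → ℝ) → ℝ} {N' D' L : (Fin (n + 2) → ℝ) →L[ℝ] ℝ}
    {y : Fin (n + 2) → ℝ} (hF : ∀ z, F z = N z / D z) (hN : HasFDerivAt N N' y)
    (hD : HasFDerivAt D D' y) (hDy : D y ≠ 0)
    (hL : ∀ v, L v = (N' v * D y - N y * D' v) / D y ^ 2) : HasFDerivAt F L y := by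
  have h := hN.mul ((hasDerivAt_inv hDy).comp_hasFDerivAt y hD)
  have hf : F = fun z => N z * ((fun x : ℝ => x⁻¹) ∘ D) z :=
    funext fun z => by rw [hF, div_eq_mul_inv]; rfl
  rw [hf]
  refine h.congr_fderiv (ContinuousLinearMap.ext fun v => ?_)
  rw [hL v]
  simp only [add_apply, FunLike.coe_smul, Pi.smul_apply, smul_eq_mul, Function.comp_apply]
  field_simp
  ring

/-- `Y` is differentiable on the min cell with derivative `fenceDeriv`. -/
theorem hasFDerivAt_fenceY {t : Fin (n + 2) → ℝ} (ht : t ∈ minCell n) :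
    HasFDerivAt fenceY (fenceDeriv t) t := by
  have hpos : ∀ i, 0 < t i := fun i => (ht.1 i).1
  have hlt : ∀ i, t 0 * t i < 1 := mul_lt_one_of_mem_minCell ht
  change HasFDerivAt (fun t i => fenceY t i) (ContinuousLinearMap.pi fun i : Fin (n + 2) =>
    fenD t i • ContinuousLinearMap.proj (R := ℝ) (φ := fun _ : Fin (n + 2) => ℝ) i +
      fenC t i • ContinuousLinearMap.proj (R := ℝ) (φ := fun _ : Fin (n + 2) => ℝ) 0) t
  rw [hasFDerivAt_pi]
  intro i
  have e0 := hasFDerivAt_apply (𝕜 := ℝ) (F' := fun _ : Fin (n + 2) => ℝ) 0 t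
  have ei := hasFDerivAt_apply (𝕜 := ℝ) (F' := fun _ : Fin (n + 2) => ℝ) i t
  by_cases hi : i = 0
  · subst hi
    simp only [fenceY, if_true]
    refine e0.congr_fderiv (ContinuousLinearMap.ext fun v => ?_)
    simp [fenD, fenC]
  by_cases he : Even i.val
  · simp only [fenceY, hi, if_false, he, if_true, cflipT]
    have hD : (0 : ℝ) < 1 + t 0 + t i - t 0 * t i := by nlinarith [hpos 0, hpos i, hlt i]
    refine hasFDerivAt_ratio (F := fun y : Fin (n + 2) → ℝ =>
        (1 - y 0 - y i - y 0 * y i) / (1 + y 0 + y i - y 0 * y i)) (fun z => by simp; ring)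
      (((e0.add ei).add (e0.mul ei)).const_sub 1)
      (((e0.add ei).sub (e0.mul ei)).const_add 1)
      (ne_of_gt (by simp only [Pi.add_apply, Pi.sub_apply, Pi.mul_apply]; linarith)) fun v => ?_
    have hD1 : 1 + t 0 + t i - t 0 * t i ≠ 0 := hD.ne'
    have hD2 : 1 + (t 0 + t i - t 0 * t i) ≠ 0 := by rw [← add_sub_assoc, ← add_assoc]; exact hD1
    simp [fenD, fenC, hi, he]
    field_simp
    ring
  · simp only [fenceY, hi, if_false, he, subT]
    have hD : (0 : ℝ) < 1 + t i * t 0 := by nlinarith [hpos 0, hpos i]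
    refine hasFDerivAt_ratio (F := fun y : Fin (n + 2) → ℝ => (y i - y 0) / (1 + y i * y 0))
      (fun z => by simp) (ei.sub e0) ((ei.mul e0).const_add 1)
      (ne_of_gt (by simp only [Pi.mul_apply]; linarith)) fun v => ?_
    simp [fenD, fenC, hi, he]
    field_simp
    ring

/-! ## The Jacobian determinant -/

/-- The matrix of `DY(t)`: diagonal `fenD` plus column `0` `fenC`. -/
theorem toMatrix_fenceDeriv (t : Fin (n + 2) → ℝ) :
    LinearMap.toMatrix' ((fenceDeriv t : (Fin (n + 2) → ℝ) →L[ℝ] (Fin (n + 2) → ℝ)) :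
      (Fin (n + 2) → ℝ) →ₗ[ℝ] (Fin (n + 2) → ℝ)) =
      Matrix.of fun i j => (if j = i then fenD t i else 0) + (if j = 0 then fenC t i else 0) := by
  ext i j
  rw [LinearMap.toMatrix'_apply, ContinuousLinearMap.coe_coe, fenceDeriv_apply, Matrix.of_apply]
  simp only [Pi.single_apply, mul_ite, mul_one, mul_zero]
  congr 1 <;> split_ifs with h1 h2 h2 <;>
    first | rfl | exact absurd h1.symm h2 | exact absurd h2.symm h1

/-- `det DY(t) = ∏ᵢ fenD t i` (lower triangular). -/
theorem det_fenceDeriv (t : Fin (n + 2) → ℝ) : (fenceDeriv t).det = ∏ i, fenD t i := by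
  rw [ContinuousLinearMap.det, ← LinearMap.det_toMatrix', toMatrix_fenceDeriv]
  rw [Matrix.det_of_lowerTriangular]
  · refine Finset.prod_congr rfl fun i _ => ?_
    rw [Matrix.of_apply]
    by_cases hi : i = 0
    · simp [hi, fenC]
    · simp [hi]
  · intro i j hij
    rw [OrderDual.toDual_lt_toDual] at hij
    have hj0 : j ≠ 0 := (lt_of_le_of_lt (Fin.zero_le i) hij).ne'
    rw [Matrix.of_apply, if_neg hij.ne', if_neg hj0, add_zero]

/-- The Jacobian factor `|det DY(t)| = ∏ᵢ |fenD t i|`. -/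
theorem abs_det_fenceDeriv (t : Fin (n + 2) → ℝ) : |(fenceDeriv t).det| = ∏ i, |fenD t i| := by
  rw [det_fenceDeriv, Finset.abs_prod]

/-! ## Weight preservation -/

/-- `W(cflipT a b)·(2(1+a²)/(1+a+b−ab)²) = W(b)`. -/
theorem tW_cflipT_mul {a b : ℝ} (h : 1 + a + b - a * b ≠ 0) :
    tW (cflipT a b) * (2 * (1 + a ^ 2) / (1 + a + b - a * b) ^ 2) = tW b := by
  have hd : (1 + a + b - a * b) ^ 2 + (1 - a - b - a * b) ^ 2 ≠ 0 := by positivity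
  unfold tW cflipT
  rw [div_pow, show (1 : ℝ) + (1 - a - b - a * b) ^ 2 / (1 + a + b - a * b) ^ 2 =
    ((1 + a + b - a * b) ^ 2 + (1 - a - b - a * b) ^ 2) / (1 + a + b - a * b) ^ 2 from by
      field_simp]
  field_simp
  ring

/-- **Weight preservation, coordinatewise**: `W(Y(t)ᵢ)·|fenD t i| = W(tᵢ)` on the min cell. -/
theorem tW_fenceY_mul {t : Fin (n + 2) → ℝ} (ht : t ∈ minCell n) (i : Fin (n + 2)) :
    tW (fenceY t i) * |fenD t i| = tW (t i) := by
  have hpos : ∀ i, 0 < t i := fun i => (ht.1 i).1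
  unfold fenceY fenD
  by_cases hi : i = 0
  · subst hi; simp
  by_cases he : Even i.val
  · simp only [hi, if_false, he, if_true]
    have hD : (0 : ℝ) < 1 + t 0 + t i - t 0 * t i := by
      nlinarith [hpos 0, hpos i, mul_lt_one_of_mem_minCell ht i]
    rw [abs_neg, abs_of_pos (div_pos (by positivity) (pow_pos hD 2))]
    exact tW_cflipT_mul hD.ne'
  · simp only [hi, if_false, he]
    have hD : (0 : ℝ) < 1 + t i * t 0 := by nlinarith [hpos 0, hpos i]
    rw [abs_of_pos (div_pos (by positivity) (pow_pos hD 2))]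
    exact tW_subT_mul hD.ne'

/-- **Weight preservation**: `w(Y t)·|det DY(t)| = w(t)` on the min cell. -/
theorem angWeight_fenceY_mul {t : Fin (n + 2) → ℝ} (ht : t ∈ minCell n) :
    angWeight (n + 2) (fenceY t) * ∏ i, |fenD t i| = angWeight (n + 2) t := by
  rw [angWeight_eq, angWeight_eq, ← Finset.prod_mul_distrib]
  exact Finset.prod_congr rfl fun i _ => tW_fenceY_mul ht i

/-! ## `Y` is a rational map -/

/-- `Y` is a `ℚ`-semialgebraic (rational) map on the min cell. -/
theorem isSemialgebraicMapOn_fenceY : IsSemialgebraicMapOn ℚ (minCell n) fenceY := by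
  refine IsSemialgebraicMapOn.of_forall (isSemialgebraic_minCell n) fun i => ?_
  by_cases hi : i = 0
  · exact (isSemialgebraicFunOn_aeval (isSemialgebraic_minCell n) (X 0)).congr
      fun s _ => by simp [fenceY, hi]
  by_cases he : Even i.val
  · refine (isSemialgebraicFunOn_aeval_div_aeval (isSemialgebraic_minCell n)
      (1 - X 0 - X i - X 0 * X i) (1 + X 0 + X i - X 0 * X i) fun s hs => ?_).congr
      fun s _ => by simp [fenceY, hi, he, cflipT]
    have h : (0 : ℝ) < 1 + s 0 + s i - s 0 * s i := by
      nlinarith [(hs.1 0).1, (hs.1 i).1, mul_lt_one_of_mem_minCell hs i]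
    simpa using h.ne'
  · refine (isSemialgebraicFunOn_aeval_div_aeval (isSemialgebraic_minCell n)
      (X i - X 0) (1 + X i * X 0) fun s hs => ?_).congr
      fun s _ => by simp [fenceY, hi, he, subT]
    have h : (0 : ℝ) < 1 + s i * s 0 := by nlinarith [(hs.1 0).1, (hs.1 i).1]
    simpa using h.ne'

/-! ## The move -/

/-- **Rule (2) along the fence chart: `[M_n, w] ≡ [F_n, w]`**, in every dimension. -/
theorem minPiece_equiv_fencePiece (n : ℕ) : Equivalent (minPiece n) (fencePiece n) :=
  equivalent_of_chart (f := angWeight (n + 2)) (g := angWeight (n + 2))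
    (J := fun t => ∏ i, |fenD t i|) isSemialgebraicMapOn_fenceY
    (fun t ht => hasFDerivAt_fenceY ht) injOn_fenceY image_fenceY (fun t _ => abs_det_fenceDeriv t)
    (fun t ht => (angWeight_fenceY_mul ht).symm) rfl
    (fun t _ => by rw [minPiece, angPiece_integrand]) rfl
    fun s _ => by rw [fencePiece, angPiece_integrand]

/-- **`[T_n, w] = (n+2)·[F_n, w]` in `Q`**, for every `n`. -/
theorem mkQ_cycPiece_eq_nsmul_fencePiece (n : ℕ) :
    mkQ (of (cycPiece n)) = (n + 2) • mkQ (of (fencePiece n)) := by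
  rw [mkQ_cycPiece_eq_nsmul_minPiece, mkQ_eq_mkQ_iff.mpr (minPiece_equiv_fencePiece n)]

end SoloBlind

end Summit.KontsevichZagierPeriods.KontsevichZagierPeriods.Theorems
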